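import Summits.HodgeConjecture.HodgeConjecture.Theses.HeckePrymWeil
import Literature.AlgebraicGeometry.Motives.FamiliesVHS
import Literature.AlgebraicGeometry.HodgeTheory.MotivatedClassesDeformation
import Literature.AlgebraicGeometry.HodgeTheory.FermatHypersurfaceReduction
import Literature.AlgebraicGeometry.HodgeTheory.ComplexConjugation
import Literature.NumberTheory.Transcendental.Analytification

/-!
# Route HeckePrymWeil — `WeilVariationalHodge` (stmt-HodgeConjecture-14497), line `Sketch`:
# reduction to quasi-compact bases (`stub_baseReduction`)

The rung `(p, M)` of the crux `HeckePrymWeil.WeilVariationalHodge` quantifies over smooth projective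
families `f : 𝒳 ⟶ S` of relative dimension `2M` over a smooth IRREDUCIBLE `ℂ`-scheme `S` that is not
assumed quasi-compact. This file proves that the rung over smooth irreducible QUASI-COMPACT bases
(`CompactSpace S.left`) implies the rung over all smooth irreducible bases.

Proof. Fix the target point `s` and the anchor `s₀` in `S(ℂ)`. Their underlying scheme points lie in
affine opens `U`, `U₀` of `S` (`exists_isAffineOpen_mem_and_subset`); `V = U ⊔ U₀` is a quasi-compact
(`IsAffineOpen.isCompact`) nonempty open subset of the irreducible `S`, hence irreducible
(`IsPreirreducible.open_subset`), and `V ⟶ S ⟶ Spec ℂ` is smooth (open immersions are smooth,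
`smooth_comp`). Both points lift to `S' = (V ⟶ Spec ℂ)` along `g : S' ⟶ S`
(`AlgPoints.liftOfMemOpensRange`). Base-change the family along `g` (`Motives.familyPullback`; again a
smooth projective family, `IsSmoothProjectiveFamily.familyPullback_snd`) and pull `W` back to
`𝒳 ×_S S'`; the fibre of the base change over `s'` is the fibre of `f` over `g s'`
(`fiberOverFamilyPullbackIso`, `map_fiberι_familyPullback`), so the fibrewise hypotheses
(`IsRationalClass.map`, `IsOfHodgeType.map_of_iso`), the Weil-fibre isomorphisms and the anchor
(`mem_algebraicClasses_map_of_iso`) move to the base change, the quasi-compact rung applies, and the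
conclusion moves back (`mem_algebraicClasses_map_of_iso`, `map_hom_map_inv_apply`).
-/

noncomputable section

-- every declaration of this problem lives in `Summit.HodgeConjecture.HodgeConjecture.…` (summit = sub-problem)
set_option linter.dupNamespace false

open CategoryTheory AlgebraicGeometry TopologicalSpace
open Literature.AlgebraicGeometry.Motives Literature.AlgebraicGeometry.HodgeTheory

namespace Summit.HodgeConjecture.HodgeConjecture.Theorems

/-! ### Geometry of the base: two complex points lie over a quasi-compact irreducible open -/

/-- **Two complex points of a smooth irreducible `ℂ`-scheme lift to a smooth irreducible
quasi-compact `ℂ`-scheme over it**: for `s, s₀ ∈ S(ℂ)` take affine opens `U ∋ pt s`, `U₀ ∋ pt s₀`;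
`V = U ⊔ U₀` is a quasi-compact nonempty open of the irreducible `S`, hence irreducible, the composite
`V ⟶ S ⟶ Spec ℂ` is smooth, and both points lift along the open immersion `V ⟶ S`. [folklore] -/
theorem exists_compactSpace_base_of_complexPoints {S : SchemeOver ℂ} [IrreducibleSpace S.left]
    [AlgebraicGeometry.Smooth S.hom] (s s₀ : ComplexPoints S) :
    ∃ (S' : SchemeOver ℂ) (g : S' ⟶ S) (t t₀ : ComplexPoints S'),
      IrreducibleSpace S'.left ∧ CompactSpace S'.left ∧ AlgebraicGeometry.Smooth S'.hom ∧
        AlgPoints.map g t = s ∧ AlgPoints.map g t₀ = s₀ := by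
  -- affine opens around the two underlying points, and their (quasi-compact) union
  obtain ⟨U, hU, hsU, -⟩ := exists_isAffineOpen_mem_and_subset (Opens.mem_top s.pt)
  obtain ⟨U₀, hU₀, hs₀U₀, -⟩ := exists_isAffineOpen_mem_and_subset (Opens.mem_top s₀.pt)
  obtain ⟨V, hVc, hsV, hs₀V⟩ :
      ∃ V : S.left.Opens, IsCompact (V : Set S.left) ∧ s.pt ∈ V ∧ s₀.pt ∈ V :=
    ⟨U ⊔ U₀, hU.isCompact.union hU₀.isCompact, Opens.mem_sup.2 (Or.inl hsU),
      Opens.mem_sup.2 (Or.inr hs₀U₀)⟩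
  -- the open subscheme `V` as a `ℂ`-scheme, and its inclusion
  let S' : SchemeOver ℂ := Over.mk (V.ι ≫ S.hom)
  let g : S' ⟶ S := Over.homMk V.ι rfl
  haveI hg : IsOpenImmersion g.left := by
    change IsOpenImmersion V.ι
    infer_instance
  have hrange : ∀ P : ComplexPoints S, P.pt ∈ V → P.pt ∈ g.left.opensRange := fun P hP =>
    ⟨⟨P.pt, hP⟩, rfl⟩
  refine ⟨S', g, AlgPoints.liftOfMemOpensRange g s (hrange s hsV),
    AlgPoints.liftOfMemOpensRange g s₀ (hrange s₀ hs₀V), ?_, ?_, ?_,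
    AlgPoints.map_liftOfMemOpensRange g s _, AlgPoints.map_liftOfMemOpensRange g s₀ _⟩
  · -- a nonempty open subset of an irreducible space is irreducible
    change IrreducibleSpace V
    exact isIrreducible_iff_irreducibleSpace.mp ⟨⟨s.pt, hsV⟩,
      (PreirreducibleSpace.isPreirreducible_univ (X := S.left)).open_subset V.isOpen
        (Set.subset_univ _)⟩
  · change CompactSpace V
    exact isCompact_iff_compactSpace.mp hVc
  · change AlgebraicGeometry.Smooth (V.ι ≫ S.hom)
    infer_instance

/-! ### Transport of the rung's data along a base change -/

section Transport

variable {p M : ℕ} {𝒳 S S' : SchemeOver ℂ} (f : 𝒳 ⟶ S) (g : S' ⟶ S)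

/-- **The fibrewise hypotheses move to the base change**: if every restriction `W|_{𝒳_s}` is rational
of type `(M, M)`, so is every restriction of `pr_𝒳^* W` to a fibre of `𝒳 ×_S S' ⟶ S'` (the fibre over
`s'` is the fibre of `f` over `g s'`: `map_fiberι_familyPullback`, `IsRationalClass.map`,
`IsOfHodgeType.map_of_iso`). [folklore] -/
theorem familyPullback_fibrewise_rational_hodge (W : complexBetti 𝒳 (2 * M))
    (hW : ∀ s : ComplexPoints S, IsRationalClass (complexBetti.map (fiberι f s) (2 * M) W) ∧
      IsOfHodgeType (2 * M) (fiberOver f s) (2 * M) M M (complexBetti.map (fiberι f s) (2 * M) W))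
    (s' : ComplexPoints S') :
    IsRationalClass (complexBetti.map (fiberι (familyPullback.snd f g) s') (2 * M)
        (complexBetti.map (familyPullback.fst f g) (2 * M) W)) ∧
      IsOfHodgeType (2 * M) (fiberOver (familyPullback.snd f g) s') (2 * M) M M
        (complexBetti.map (fiberι (familyPullback.snd f g) s') (2 * M)
          (complexBetti.map (familyPullback.fst f g) (2 * M) W)) := by
  rw [map_fiberι_familyPullback]
  exact ⟨(hW _).1.map _, (hW _).2.map_of_iso _⟩

/-- **The Weil-fibre isomorphisms move to the base change**: compose the given
`A'.X ≅ 𝒳_{g s'}` with `(𝒳 ×_S S')_{s'} ≅ 𝒳_{g s'}` (`fiberOverFamilyPullbackIso`) reversed. [folklore] -/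
theorem familyPullback_fibrewise_weil
    (hA : ∀ s : ComplexPoints S, ∃ (A' : AbelianVariety ℂ) (φ' : A' ⟶ A'), A'.dim = (2 * M) ∧
      φ' ≫ φ' = -((p : ℤ) • 𝟙 A') ∧ Nonempty (A'.X ≅ fiberOver f s))
    (s' : ComplexPoints S') :
    ∃ (A' : AbelianVariety ℂ) (φ' : A' ⟶ A'), A'.dim = (2 * M) ∧
      φ' ≫ φ' = -((p : ℤ) • 𝟙 A') ∧ Nonempty (A'.X ≅ fiberOver (familyPullback.snd f g) s') := by
  obtain ⟨A', φ', hdim, hφ, ⟨e⟩⟩ := hA (AlgPoints.map g s')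
  exact ⟨A', φ', hdim, hφ, ⟨e ≪≫ (fiberOverFamilyPullbackIso f g s').symm⟩⟩

variable {f} in
/-- **Algebraicity of the restrictions is invariant under base change**: for a smooth projective
family `f`, the restriction of `pr_𝒳^* W` to `(𝒳 ×_S S')_{s'}` is algebraic iff the restriction of `W`
to `𝒳_{g s'}` is (transport along the isomorphism of smooth projective fibres
`fiberOverFamilyPullbackIso`, `mem_algebraicClasses_map_of_iso`, `map_hom_map_inv_apply`). [folklore] -/
theorem familyPullback_mem_algebraicClasses_iff {n : ℕ} (hf : IsSmoothProjectiveFamily f n)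
    (q : ℕ) (W : complexBetti 𝒳 (2 * q)) (s' : ComplexPoints S') :
    complexBetti.map (fiberι (familyPullback.snd f g) s') (2 * q)
        (complexBetti.map (familyPullback.fst f g) (2 * q) W) ∈
          algebraicClasses (fiberOver (familyPullback.snd f g) s') q ↔
      complexBetti.map (fiberι f (AlgPoints.map g s')) (2 * q) W ∈
        algebraicClasses (fiberOver f (AlgPoints.map g s')) q := by
  rw [map_fiberι_familyPullback]
  refine ⟨fun h => ?_, fun h => mem_algebraicClasses_map_of_iso (hf.isSmoothProjective _)
    ((hf.familyPullback_snd g).isSmoothProjective s') (fiberOverFamilyPullbackIso f g s') h⟩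
  have back := mem_algebraicClasses_map_of_iso ((hf.familyPullback_snd g).isSmoothProjective s')
    (hf.isSmoothProjective _) (fiberOverFamilyPullbackIso f g s').symm h
  have hid : complexBetti.map (fiberOverFamilyPullbackIso f g s').symm.hom (2 * q)
      (complexBetti.map (fiberOverFamilyPullbackIso f g s').hom (2 * q)
        (complexBetti.map (fiberι f (AlgPoints.map g s')) (2 * q) W)) =
      complexBetti.map (fiberι f (AlgPoints.map g s')) (2 * q) W :=
    map_hom_map_inv_apply (fiberOverFamilyPullbackIso f g s').symm (2 * q) _
  rw [hid] at back
  exact back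

end Transport

/-! ### The reduction -/

/-- **Stub (base reduction).** The rung of `WeilVariationalHodge` over smooth irreducible QUASI-COMPACT bases
(`CompactSpace S.left`) implies the rung over all smooth irreducible bases: for `s, s₀ ∈ S(ℂ)` take affine opens
`U ∋ pt s`, `U₀ ∋ pt s₀`; `V = U ∪ U₀` is a quasi-compact open of the irreducible `S`, hence irreducible, and
`V ⟶ S ⟶ Spec ℂ` is smooth; restrict the family along `V ⟶ S` (`Motives.familyPullback`), pull `W` back to
`𝒳 ×_S V`, move the fibrewise hypotheses, the Weil-fibre isomorphisms and the anchor across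
`fiberOverFamilyPullbackIso` (`map_fiberι_familyPullback`, `IsRationalClass.map`, `IsOfHodgeType.map_of_iso`,
`mem_algebraicClasses_map_of_iso`), apply the hypothesis, and move the conclusion back. [folklore] -/
theorem stub_baseReduction (p M : ℕ) :
    (∀ ⦃𝒳 S : SchemeOver ℂ⦄ (f : 𝒳 ⟶ S), IsSmoothProjectiveFamily f (2 * M) → IrreducibleSpace S.left →
      CompactSpace S.left → AlgebraicGeometry.Smooth S.hom → ∀ (W : complexBetti 𝒳 (2 * M)),
      (∀ s : ComplexPoints S, IsRationalClass (complexBetti.map (fiberι f s) (2 * M) W) ∧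
        IsOfHodgeType (2 * M) (fiberOver f s) (2 * M) M M (complexBetti.map (fiberι f s) (2 * M) W)) →
      (∀ s : ComplexPoints S, ∃ (A' : AbelianVariety ℂ) (φ' : A' ⟶ A'), A'.dim = (2 * M) ∧
        φ' ≫ φ' = -((p : ℤ) • 𝟙 A') ∧ Nonempty (A'.X ≅ fiberOver f s)) →
      (∃ s₀ : ComplexPoints S, complexBetti.map (fiberι f s₀) (2 * M) W ∈ algebraicClasses (fiberOver f s₀) M) →
      ∀ s : ComplexPoints S, complexBetti.map (fiberι f s) (2 * M) W ∈ algebraicClasses (fiberOver f s) M) →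
    ∀ ⦃𝒳 S : SchemeOver ℂ⦄ (f : 𝒳 ⟶ S), IsSmoothProjectiveFamily f (2 * M) → IrreducibleSpace S.left →
      AlgebraicGeometry.Smooth S.hom → ∀ (W : complexBetti 𝒳 (2 * M)),
      (∀ s : ComplexPoints S, IsRationalClass (complexBetti.map (fiberι f s) (2 * M) W) ∧
        IsOfHodgeType (2 * M) (fiberOver f s) (2 * M) M M (complexBetti.map (fiberι f s) (2 * M) W)) →
      (∀ s : ComplexPoints S, ∃ (A' : AbelianVariety ℂ) (φ' : A' ⟶ A'), A'.dim = (2 * M) ∧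
        φ' ≫ φ' = -((p : ℤ) • 𝟙 A') ∧ Nonempty (A'.X ≅ fiberOver f s)) →
      (∃ s₀ : ComplexPoints S, complexBetti.map (fiberι f s₀) (2 * M) W ∈ algebraicClasses (fiberOver f s₀) M) →
      ∀ s : ComplexPoints S, complexBetti.map (fiberι f s) (2 * M) W ∈ algebraicClasses (fiberOver f s) M := by
  intro h 𝒳 S f hf hirr hsm W hW hA hs₀ s
  obtain ⟨s₀, hs₀⟩ := hs₀
  haveI := hirr
  haveI := hsm
  -- replace `S` by a quasi-compact irreducible open through `s` and `s₀`
  obtain ⟨S', g, t, t₀, hirr', hcpt', hsm', rfl, rfl⟩ :=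
    exists_compactSpace_base_of_complexPoints s s₀
  rw [← familyPullback_mem_algebraicClasses_iff g hf M W t]
  exact h (familyPullback.snd f g) (hf.familyPullback_snd g) hirr' hcpt' hsm' _
    (familyPullback_fibrewise_rational_hodge f g W hW) (familyPullback_fibrewise_weil f g hA)
    ⟨t₀, (familyPullback_mem_algebraicClasses_iff g hf M W t₀).2 hs₀⟩ t

end Summit.HodgeConjecture.HodgeConjecture.Theorems

end
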